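import Literature.Geometry.Kaehler.ComplexTorusEquivariantEndomorphismAlgebraCommutantAnalyticCriterion
import Literature.RepresentationTheory.FiniteGroups.BrauerTheorem
import HarnessLib

/-!
# Eigencharacters of the analytic representation: for abelian `G`, `End_ℚ^G(X) = End_{ℚ[G]}(H₁(X,ℚ))`
# iff no character `θ` of `G` and its inverse `θ̄` are both eigencharacters of `ρ_a`

Layer `Literature/Geometry/Kaehler`, namespace `Literature.Geometry.Kaehler.ComplexTorus`; lane `lit-hodgefound`
(Track 2 foundations library), Layer A2, row «A2-26(dp)» (self-proposed 2026-08-27, prover seat `lit-hodgefound-p10`,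
generation 23, FILE 10).  Sequel of FILE 8 `…CommutantAnalyticCriterion.lean` (THE ANALYTIC CRITERION
`endAlgRatG_eq_centralizer_iff_forall_tangentRep`: equality iff for every `χ ∈ Irr(G)` one of `ρ_a(e_χ)`,
`ρ_a(e_{χ̄})` vanishes, `ρ_a = tangentRep ρ` the analytic representation on `E = T_0X`).  CONSUMED BY NAME: p38's
`charIdempotent` (`e_χ = χ(1)/|G| Σ_g χ(g⁻¹) g`), `IsIrrChar`, `isIrreducible_of_finrank_eq_one`,
`IsIrrChar.map_one` / `IsIrrChar.map_mul` (`BrauerTheorem`: irreducible characters of an abelian group are linear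
and multiplicative — Schur, via Mathlib's `Representation.IsIrreducible.finrank_eq_one_of_isMulCommutative`),
`Representation.asAlgebraHom_of`.

## The mathematics

For a homomorphism `θ : G → ℂ^×` the idempotent `e_θ = |G|⁻¹ Σ_h θ(h)⁻¹ h` satisfies `g e_θ = θ(g) e_θ`, so on any
representation `τ` the operator `τ(e_θ)` is the projector onto the `θ`-eigenspace
`{v : τ(g)v = θ(g)v ∀ g}`; in particular `τ(e_θ) = 0` iff `θ` is not an eigencharacter of `τ`.  For ABELIAN `G` every
irreducible character is such a `θ` (Schur), and `θ̄ = θ⁻¹`; FILE 8's criterion becomes: **`End_ℚ^G(X) =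
End_{ℚ[G]}(H₁(X,ℚ))` iff for every character `θ` of `G`, `θ` and `θ̄` are not both eigencharacters of the analytic
representation `ρ_a` on `T_0X`** — for cyclic `G = ⟨σ⟩` of order `n`: iff no two mutually inverse `n`-th roots of
unity `ζ, ζ̄` are both eigenvalues of `ρ_a(σ)` ("`n_k n_{-k} = 0`").

## Sources, VERBATIM (held texts)

* I. Dolgachev, Yu. G. Zarhin, *Endomorphisms of Complex Abelian Varieties* (2024; held
  `paper:galaxy-pdf-8712177384607648460`), §2.2 p0035–p0036: Remark 2.17 and Thm. 2.18 (an automorphism `δ` of prime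
  order `ℓ` with `Φ_ℓ(δ) = 0`; the eigenvalue multiplicities of `δ` on `T_0A`; "`B` is an abelian variety of CM-type
  … with multiplication by `ℤ[ζ_ℓ]`").
* C. Birkenhake, H. Lange, *Complex Abelian Varieties*, 2nd ed. (2004), §13.3 (abelian varieties with an automorphism
  of order `d`: the eigenvalues of `ρ_a(σ)` and `ρ_r ⊗ ℂ ≅ ρ_a ⊕ \overline{ρ_a}`), Cor. 13.3.4–13.3.5.
* H. Lange, R. E. Rodríguez, *Decomposition of Jacobians by Prym Varieties*, LNM 2310 (2022; held
  `book:lange2022-decomposition-jacobians-by-prym-varieties`), §2.2 (2.6) p0029; §2.8 Lemma 2.8.1 p0040 (characters of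
  abelian groups and the idempotents `p_H`); §2.9.2 p0046.
* I. M. Isaacs, *Character Theory of Finite Groups* (1976; held), Thm. 2.12 (`e_χ`), Cor. 2.23 (linear characters are
  homomorphisms), (2.6)/Cor. 2.6 (abelian ⟺ all irreducible characters linear); J.-P. Serre, *Linear Representations
  of Finite Groups*, §3.1 Thm. 9 (abelian groups), §2.6 Thm. 8.

## What is proved (theorems only; NO definition, NO named fact, no `sorry`)

`G : Type` finite, `θ : G →* ℂ`, `τ : Representation ℂ G V` arbitrary, `ρ : G →* End_ℚ(X)`, `ρ_a = tangentRep ρ`.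
* §1 `e_θ`: `charIdempotent_coe_monoidHom` (`e_θ = |G|⁻¹ Σ_h θ(h⁻¹) h`), `monoidHom_apply_inv_mul`,
  **`of_mul_charIdempotent_coe_monoidHom`** (`g e_θ = θ(g) e_θ`), `asAlgebraHom_charIdempotent_apply_of_forall`
  (`τ(e_θ) v = v` on `θ`-eigenvectors), `apply_asAlgebraHom_charIdempotent_coe_monoidHom` (`τ(e_θ) u` is a
  `θ`-eigenvector), **`asAlgebraHom_charIdempotent_coe_monoidHom_eq_zero_iff`** (`τ(e_θ) = 0 ⟺ no θ-eigenvector`),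
  `coe_conj_comp` (`θ̄`), `forall_apply_eq_smul_iff_of_forall_mem_zpowers` (for `G = ⟨σ⟩`: `θ`-eigenvector iff
  `τ(σ) v = θ(σ) v`).
* §2 abelian `G`: `exists_monoidHom_coe_eq_of_isIrrChar` (p38's Schur lemmas packaged as a `MonoidHom`),
  **`endAlgRatG_eq_centralizer_iff_forall_monoidHom`: equality ⟺ ∀ θ : G →* ℂ, ρ_a has no `θ`-eigenvector or no
  `θ̄`-eigenvector**, and the cyclic form **`endAlgRatG_eq_centralizer_iff_forall_monoidHom_of_forall_mem_zpowers`**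
  (`G = ⟨σ⟩`: ⟺ ∀ θ, `θ(σ)` and `\overline{θ(σ)}` are not both eigenvalues of `ρ_a(σ)`);
  `endAlgRatG_ne_centralizer_of_eigenvector` (a pair of eigenvectors for `θ`, `θ̄` forces strict inclusion).

## References

* [DolgachevZarhin2024] I. Dolgachev, Yu. G. Zarhin, *Endomorphisms of Complex Abelian Varieties* (2024), §2.2
  Remark 2.17, Thm. 2.18.
* [BirkenhakeLange2004] C. Birkenhake, H. Lange, *Complex Abelian Varieties*, 2nd ed. (2004), §13.3.
* [LangeRodriguez2022] H. Lange, R. E. Rodríguez, *Decomposition of Jacobians by Prym Varieties*, LNM 2310 (2022),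
  §2.2 (2.6); §2.8 Lemma 2.8.1; §2.9.2.
* [Isaacs1976] I. M. Isaacs, *Character Theory of Finite Groups* (1976), Thm. 2.12, Cor. 2.6, Cor. 2.23.
* [SerreLinearRepresentations1977] J.-P. Serre, *Linear Representations of Finite Groups* (1977), §2.6 Thm. 8, §3.1 Thm. 9.
-/

noncomputable section

open Module Function
open scoped Matrix

namespace Literature.Geometry.Kaehler

namespace ComplexTorus

open Literature.RepresentationTheory.FiniteGroups

universe u

/-! ### §1 The idempotent `e_θ` of a character `θ : G → ℂ^×` and `θ`-eigenvectors -/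

section Linear

variable {G : Type} [Group G] [Fintype G]

omit [Fintype G] in
/-- A homomorphism `θ : G → ℂ^×` is an irreducible character (of the one-dimensional representation `θ`).
[cite: Isaacs1976, Cor. 2.23 and Def. 2.1 (linear characters), p0030] -/
private theorem isIrrChar_coe_monoidHom_a (θ : G →* ℂ) : IsIrrChar G ⇑θ := by
  let ρ₁ : Representation ℂ G ℂ := (DistribMulAction.toModuleEnd ℂ ℂ).comp θ
  refine ⟨ℂ, _, _, inferInstance, ρ₁, isIrreducible_of_finrank_eq_one ρ₁ (finrank_self ℂ), funext fun g ↦ ?_⟩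
  show LinearMap.trace ℂ ℂ (DistribMulAction.toModuleEnd ℂ ℂ (θ g)) = θ g
  have : DistribMulAction.toModuleEnd ℂ ℂ (θ g) = θ g • LinearMap.id := by ext; simp
  rw [this, map_smul, LinearMap.trace_id, finrank_self, Nat.cast_one, smul_eq_mul, mul_one]

/-- **`e_θ = |G|⁻¹ Σ_h θ(h⁻¹) h`** for a homomorphism `θ` (`θ(1) = 1`). [cite: Isaacs1976, Thm. 2.12, p0024] [cite: LangeRodriguez2022, §2.8 (2.24) and Lemma 2.8.1, p0040–p0041] -/
theorem charIdempotent_coe_monoidHom (θ : G →* ℂ) :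
    charIdempotent ⇑θ = ∑ h : G, ((Fintype.card G : ℂ)⁻¹ * θ h⁻¹) • MonoidAlgebra.of ℂ G h := by
  simp only [charIdempotent, map_one, one_div]

omit [Fintype G] in
/-- `θ(h⁻¹) θ(h) = 1`. [cite: Isaacs1976, Cor. 2.23, p0030] -/
theorem monoidHom_apply_inv_mul (θ : G →* ℂ) (h : G) : θ h⁻¹ * θ h = 1 := by
  rw [← map_mul, inv_mul_cancel, map_one]

/-- **`g e_θ = θ(g) e_θ`.** [cite: LangeRodriguez2022, §2.8 (ii) after (2.24) (`h p_H = p_H`), p0042] [cite: Isaacs1976, Thm. 2.12, p0024] -/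
theorem of_mul_charIdempotent_coe_monoidHom (θ : G →* ℂ) (g : G) :
    MonoidAlgebra.of ℂ G g * charIdempotent ⇑θ = θ g • charIdempotent ⇑θ := by
  rw [charIdempotent_coe_monoidHom, Finset.mul_sum, Finset.smul_sum]
  refine Fintype.sum_equiv (Equiv.mulLeft g) _ _ fun h ↦ ?_
  have hg : θ g * θ g⁻¹ = 1 := by rw [← map_mul, mul_inv_cancel, map_one]
  simp only [Equiv.coe_mulLeft]
  rw [Algebra.mul_smul_comm, ← map_mul, smul_smul, mul_inv_rev, map_mul θ]
  congr 1
  linear_combination (-((Fintype.card G : ℂ)⁻¹ * θ h⁻¹)) * hg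

variable {V : Type*} [AddCommGroup V] [Module ℂ V] (τ : Representation ℂ G V)

/-- **`τ(e_θ) v = v` for a `θ`-eigenvector `v`** (`τ(g) v = θ(g) v` for all `g`).
[cite: SerreLinearRepresentations1977, §2.6 Thm. 8 (the projector `p_i`)] [cite: Isaacs1976, Thm. 2.12, p0024] -/
theorem asAlgebraHom_charIdempotent_apply_of_forall (θ : G →* ℂ) {v : V} (hv : ∀ g : G, τ g v = θ g • v) :
    τ.asAlgebraHom (charIdempotent ⇑θ) v = v := by
  rw [charIdempotent_coe_monoidHom, map_sum, LinearMap.sum_apply]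
  simp_rw [map_smul, Representation.asAlgebraHom_of, LinearMap.smul_apply, hv, smul_smul, mul_assoc,
    monoidHom_apply_inv_mul, mul_one]
  rw [Finset.sum_const, Finset.card_univ, ← Nat.cast_smul_eq_nsmul ℂ, smul_smul,
    mul_inv_cancel₀ (Nat.cast_ne_zero.2 Fintype.card_ne_zero), one_smul]

/-- **`τ(e_θ) u` is a `θ`-eigenvector**: `τ(g) τ(e_θ) u = θ(g) τ(e_θ) u`. [cite: SerreLinearRepresentations1977, §2.6 Thm. 8] [cite: Isaacs1976, Thm. 2.12, p0024] -/
theorem apply_asAlgebraHom_charIdempotent_coe_monoidHom (θ : G →* ℂ) (g : G) (u : V) :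
    τ g (τ.asAlgebraHom (charIdempotent ⇑θ) u) = θ g • τ.asAlgebraHom (charIdempotent ⇑θ) u := by
  rw [← Representation.asAlgebraHom_of, ← Module.End.mul_apply, ← map_mul,
    of_mul_charIdempotent_coe_monoidHom, map_smul, LinearMap.smul_apply]

/-- **`τ(e_θ) = 0` iff `θ` is not an eigencharacter of `τ`** (no non-zero `v` with `τ(g)v = θ(g)v` for all `g`).
[cite: SerreLinearRepresentations1977, §2.6 Thm. 8] [cite: LangeRodriguez2022, §2.8 Prop. 2.8.6 (`f_{H,W} ≠ 0 ⟺ dim V^H ≠ 0`), p0042] -/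
theorem asAlgebraHom_charIdempotent_coe_monoidHom_eq_zero_iff (θ : G →* ℂ) :
    τ.asAlgebraHom (charIdempotent ⇑θ) = 0 ↔ ∀ v : V, (∀ g : G, τ g v = θ g • v) → v = 0 := by
  constructor
  · intro h v hv
    rw [← asAlgebraHom_charIdempotent_apply_of_forall τ θ hv, h, LinearMap.zero_apply]
  · intro h
    refine LinearMap.ext fun u ↦ ?_
    rw [LinearMap.zero_apply]
    exact h _ fun g ↦ apply_asAlgebraHom_charIdempotent_coe_monoidHom τ θ g u

omit [Fintype G] in
/-- The conjugate character `θ̄ = conj ∘ θ` (`= θ⁻¹` on a finite group). [cite: Isaacs1976, Cor. 2.23 and Problem 2.2, p0030] -/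
theorem coe_conj_comp (θ : G →* ℂ) : ⇑((starRingEnd ℂ).toMonoidHom.comp θ) = star ⇑θ := by
  funext g
  rw [MonoidHom.coe_comp, Function.comp_apply, RingHom.toMonoidHom_eq_coe, MonoidHom.coe_coe, Pi.star_apply,
    Complex.star_def]

omit [Fintype G] in
/-- For `G = ⟨σ⟩`: `v` is a `θ`-eigenvector iff `τ(σ) v = θ(σ) v`. [cite: BirkenhakeLange2004, §13.3 (eigenvalues of `ρ_a(σ)`)] [cite: DolgachevZarhin2024, §2.2 Thm. 2.18, p0036] -/
theorem forall_apply_eq_smul_iff_of_forall_mem_zpowers [Finite G] {σ : G} (hσ : ∀ g : G, g ∈ Subgroup.zpowers σ)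
    (θ : G →* ℂ) (v : V) : (∀ g : G, τ g v = θ g • v) ↔ τ σ v = θ σ • v := by
  refine ⟨fun h ↦ h σ, fun h g ↦ ?_⟩
  obtain ⟨k, rfl⟩ := ((isOfFinOrder_of_finite σ).mem_powers_iff_mem_zpowers.2 (hσ g))
  rw [map_pow, map_pow]
  induction k with
  | zero => rw [pow_zero, pow_zero, Module.End.one_apply, one_smul]
  | succ k ih => rw [pow_succ, pow_succ, Module.End.mul_apply, h, map_smul, ih, smul_smul, mul_comm]

end Linear

/-! ### §2 Abelian `G`: the eigencharacter criterion -/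

section Abelian

variable {G : Type} [Group G] [Fintype G]

omit [Fintype G] in
/-- **For abelian `G` every irreducible character is a homomorphism `G → ℂ^×`.** [cite: Isaacs1976, Cor. 2.6 and Cor. 2.23, p0016, p0030] [cite: SerreLinearRepresentations1977, §3.1 Thm. 9] -/
theorem exists_monoidHom_coe_eq_of_isIrrChar [IsMulCommutative G] {χ : G → ℂ} (hχ : IsIrrChar G χ) :
    ∃ θ : G →* ℂ, ⇑θ = χ :=
  ⟨{ toFun := χ, map_one' := hχ.map_one, map_mul' := hχ.map_mul }, rfl⟩

variable {ι : Type u} [Fintype ι] [DecidableEq ι] {E : Type*} [NormedAddCommGroup E] [NormedSpace ℂ E]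
  {Φ : (ι → ℝ) ≃L[ℝ] E} (ρ : G →* endAlgRat Φ)

/-- **THE EIGENCHARACTER CRITERION (abelian `G`).  `End_ℚ^G(X) = End_{ℚ[G]}(H₁(X,ℚ))` iff for every character
`θ : G → ℂ^×`, the analytic representation `ρ_a` on `T_0X` has no `θ`-eigenvector or no `θ̄`-eigenvector** —
`θ` and `θ̄ = θ⁻¹` are never both eigencharacters of `ρ_a` (each eigenspace `H₁(X,ℂ)_θ` lies in `T_0X = V^{-1,0}`
or in `V^{0,-1} = \overline{T_0X}`).  [cite: DolgachevZarhin2024, §2.2 Remark 2.17 and Thm. 2.18, p0035–p0036]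
[cite: BirkenhakeLange2004, §13.3] [cite: LangeRodriguez2022, §2.2 (2.6), p0029] -/
theorem endAlgRatG_eq_centralizer_iff_forall_monoidHom [IsMulCommutative G] :
    endAlgRatG Φ ρ = Subalgebra.centralizer ℚ (Set.range fun g : G ↦ ((ρ g : endAlgRat Φ) : Matrix ι ι ℚ)) ↔
      ∀ θ : G →* ℂ,
        (∀ v : E, (∀ g : G, tangentRep ρ g v = θ g • v) → v = 0) ∨
          (∀ v : E, (∀ g : G, tangentRep ρ g v = starRingEnd ℂ (θ g) • v) → v = 0) := by
  rw [endAlgRatG_eq_centralizer_iff_forall_tangentRep]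
  have hconj : ∀ θ : G →* ℂ, (tangentRep ρ).asAlgebraHom (charIdempotent (star ⇑θ)) = 0 ↔
      ∀ v : E, (∀ g : G, tangentRep ρ g v = starRingEnd ℂ (θ g) • v) → v = 0 := fun θ ↦ by
    rw [← coe_conj_comp, asAlgebraHom_charIdempotent_coe_monoidHom_eq_zero_iff]
    rfl
  constructor
  · intro h θ
    rcases h _ (isIrrChar_coe_monoidHom_a θ) with h1 | h1
    · exact Or.inl ((asAlgebraHom_charIdempotent_coe_monoidHom_eq_zero_iff _ θ).1 h1)
    · exact Or.inr ((hconj θ).1 h1)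
  · intro h χ hχ
    obtain ⟨θ, rfl⟩ := exists_monoidHom_coe_eq_of_isIrrChar hχ
    rcases h θ with h1 | h1
    · exact Or.inl ((asAlgebraHom_charIdempotent_coe_monoidHom_eq_zero_iff _ θ).2 h1)
    · exact Or.inr ((hconj θ).2 h1)

/-- **Cyclic `G = ⟨σ⟩`: equality iff for every character `θ`, `θ(σ)` and `\overline{θ(σ)}` are not both eigenvalues
of `ρ_a(σ)`** (`n`-th roots of unity `ζ^k`, `ζ^{-k}` with `n_k n_{-k} ≠ 0` are the obstruction).
[cite: DolgachevZarhin2024, §2.2 Thm. 2.18 (`δ` of prime order, `B` of CM-type by `ℤ[ζ_ℓ]`), p0036] [cite: BirkenhakeLange2004, §13.3 Cor. 13.3.4–13.3.5] -/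
theorem endAlgRatG_eq_centralizer_iff_forall_monoidHom_of_forall_mem_zpowers [IsMulCommutative G] {σ : G}
    (hσ : ∀ g : G, g ∈ Subgroup.zpowers σ) :
    endAlgRatG Φ ρ = Subalgebra.centralizer ℚ (Set.range fun g : G ↦ ((ρ g : endAlgRat Φ) : Matrix ι ι ℚ)) ↔
      ∀ θ : G →* ℂ,
        (∀ v : E, tangentRep ρ σ v = θ σ • v → v = 0) ∨
          (∀ v : E, tangentRep ρ σ v = starRingEnd ℂ (θ σ) • v → v = 0) := by
  rw [endAlgRatG_eq_centralizer_iff_forall_monoidHom ρ]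
  refine forall_congr' fun θ ↦ ?_
  have h2 : ∀ v : E, (∀ g : G, tangentRep ρ g v = starRingEnd ℂ (θ g) • v) ↔
      tangentRep ρ σ v = starRingEnd ℂ (θ σ) • v := fun v ↦ by
    have h := forall_apply_eq_smul_iff_of_forall_mem_zpowers (tangentRep ρ) hσ
      ((starRingEnd ℂ).toMonoidHom.comp θ) v
    simp only [coe_conj_comp, Pi.star_apply, Complex.star_def] at h
    exact h
  simp only [forall_apply_eq_smul_iff_of_forall_mem_zpowers (tangentRep ρ) hσ θ, h2]

/-- **A pair of eigenvectors of `ρ_a` for `θ` and `θ̄` forces `End_ℚ^G(X) ⊊ End_{ℚ[G]}(H₁(X,ℚ))`** (any `G`).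
[cite: DolgachevZarhin2024, §2.2 Remark 2.17 (`d ≤ r²`, strict in general), p0035] [cite: LangeRodriguez2022, §2.2 (2.6), p0029] -/
theorem endAlgRatG_ne_centralizer_of_eigenvector (θ : G →* ℂ) {v w : E} (hv : v ≠ 0)
    (hρv : ∀ g : G, tangentRep ρ g v = θ g • v) (hw : w ≠ 0)
    (hρw : ∀ g : G, tangentRep ρ g w = starRingEnd ℂ (θ g) • w) :
    endAlgRatG Φ ρ ≠ Subalgebra.centralizer ℚ (Set.range fun g : G ↦ ((ρ g : endAlgRat Φ) : Matrix ι ι ℚ)) := by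
  intro h
  rcases (endAlgRatG_eq_centralizer_iff_forall_tangentRep ρ).1 h _ (isIrrChar_coe_monoidHom_a θ) with h1 | h1
  · exact hv ((asAlgebraHom_charIdempotent_coe_monoidHom_eq_zero_iff _ θ).1 h1 v hρv)
  · rw [← coe_conj_comp, asAlgebraHom_charIdempotent_coe_monoidHom_eq_zero_iff] at h1
    exact hw (h1 w hρw)

end Abelian

end ComplexTorus

end Literature.Geometry.Kaehler
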